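import Literature.Analysis.Calculus.BCHDynkin
import Literature.Analysis.Calculus.BCHDynkinLowOrder
import Literature.MathematicalPhysics.QuantumFieldTheory.Balaban1983to89.B7Eq31BCH

/-!
# Bałaban's renormalization group for lattice gauge theories — B7 §A (29): the Baker–Campbell–Hausdorff–DYNKIN
series of `Z = log e^X e^Y`, with an admissible `c₀` (`B7Eq29Dynkin`)

statement-level skeleton of published theorems with citation tags; proofs where landed; nothing here is a claim about the Yang–Mills mass gap

CITATION HEADER.  Cell `lit-balaban` (unit r04 gen 7, B7 owner; file 4/4 of the programme started by p28 gen 6: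
`Analysis/Calculus/ExpDifferentialLogQuotient` (p253631) → `Analysis/Calculus/OrderedProductSums` (p253996) →
`Analysis/Calculus/BCHDynkin` (p267904) → THIS FILE; v1.1 adds the side file `Analysis/Calculus/BCHDynkinLowOrder`
(p270701) for §4), SKELETON row B7.Eq28 «(28)–(29)».  Source: T. Bałaban, *Averaging
operations for lattice gauge theories*, Commun. Math. Phys. **98**, 17–51 (1985) [Balaban1985Averaging], §A p. 22
[PDF 6], read from the page render `b2b-balaban-ref1/pages/1985-cmp98-averaging/1985-cmp98-averaging-p006-x2.png`
AS AN IMAGE.  Companions: `B7Eq38Remainder` ((28): `Z2 X Y (u,v) = log e^{uX}e^{vY}`, its domain `dom28`, (36)–(41)),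
`B7Eq31BCH` ((30), (31) with `c₁ = 1/10`; its header lists «(29) itself» as NOT REPRODUCED — closed here),
`B7Eq32ExpDifferential` ((32)–(35)), `MatrixLog` (`log` = the series (21) = `mlog`, `mlog W = logOnePlus (W − 1)`).

THE PRINTED TEXT (p. 22).  «Let us define `Z(u, v) = log e^{uX}e^{vY}`. (28)  It is a well-defined and analytic function
of `uX`, `vY`, for example, in the domain `|uX| < ⅛`, `|vY| < ⅛`.  Its power series expansion is given by the
Baker-Campbell-Haussdorf formula (see [7], Sect. 2.15)
`Z = log e^X e^Y = Σ_{m=1}^∞ Σ_{pᵢ+qᵢ≥1} ((−1)^{m+1}/m) · (p₁+p₂+…+p_m+q₁+q₂+…+q_m)⁻¹ · (p₁!q₁!·…·p_m!q_m!)⁻¹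
(ad_X)^{p₁}(ad_Y)^{q₁}·…·(ad_X)^{p_m}(ad_Y)^{q_m−1} Y = X + Y + ½[X, Y] + (1/12)[Y, [Y, X]] + (1/12)[X, [X, Y]] + …`, (29)
where `ad_X Y = [X, Y] = XY − YX`, and the series is convergent in a neighborhood of `0`: `|X|, |Y| ≤ c₀` for some
positive `c₀`.» ([7] = [Varadarajan1984]; the formula is Ch. 2 Exercise 44 (d) there, «due to Dynkin».)

WHAT THIS FILE PROVES (kernel; `𝔸` any complex Banach algebra, `log` = the series (21) = `MatrixLog.mlog`; the general
term, the multi-index set and the bracket are those of `Literature.Analysis.Calculus.BCH` (`dynkinTerm`, `Idx`,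
`dynkinBracket`), where `hasSum_dynkinTerm` PROVES Dynkin's formula by the printed proof of [Rossmann2002, §1.3 Thm 1]):
* **(29) with an admissible `c₀`**: `eq29_printed` — for `‖X‖ ≤ 1/10`, `‖Y‖ ≤ 1/10` the family of ALL terms of (29)
  (indices `m ≥ 1`, `(p₁,q₁,…,p_m,q_m)` with `pᵢ + qᵢ ≥ 1`) is summable with sum `log (e^X e^Y)`; `eq29_summable_norm`
  (the convergence is absolute), `eq29_tsum` (`log e^X e^Y = Σ' …`), `eq29_of_sum_le` (the same under `‖X‖ + ‖Y‖ ≤ 1/5`).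
  So **`c₀ = 1/10` IS ADMISSIBLE**, and `B7Eq31BCH`'s admissible `c₁ = 1/10` of (31) satisfies the printed «`c₁ ≤ c₀`»
  (`eq29_and_eq31`: on `|X|, |Y| ≤ 1/10` both (29) and (31) hold).
* **(29) for `Z(u,v)` of (28)**: `eq29_Z2` — «its power series expansion»: `Z2 X Y (u,v) = Σ dynkinTerm (uX) (vY)` whenever
  `|u|‖X‖ ≤ 1/10`, `|v|‖Y‖ ≤ 1/10` (inside the printed domain `|uX| < ⅛`, `|vY| < ⅛` the condition `‖uX‖ + ‖vY‖ ≤ 1/5`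
  of `eq29_Z2_of_sum_le` is what is certified).
* **The printed general term.**  `eq29_term_printed`: when `q_m ≥ 1` the bracket `[X^{(p₁)}Y^{(q₁)}⋯X^{(p_m)}Y^{(q_m)}]`
  IS the printed operator word `(ad_X)^{p₁}(ad_Y)^{q₁}⋯(ad_X)^{p_m}(ad_Y)^{q_m−1}Y` (`ad_X` = the tree's
  `ExpDifferential.ad ℂ X`, `ad_X Y = XY − YX`); `eq29_lastBlock`: the last block contributes `(ad_X)^{p_m}Y` (`q_m = 1`),
  `X` (`(p_m,q_m) = (1,0)`), and `0` otherwise; `eq29_term_X`, `eq29_term_Y`, `eq29_term_XY`: the displayed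
  `X + Y + ½[X,Y]` are the terms `m = 1`, `(p₁,q₁) ∈ {(1,0), (0,1), (1,1)}`.
* **The displayed third-order terms and the tail (v1.1, §4).**  `eq29_lowDeg`: the finitely many terms of (29) of total
  degree `p₁+…+q_m ≤ 3` (`42` multi-indices, `BCH.lowIdx`) sum EXACTLY to the displayed
  `X + Y + ½[X,Y] + (1/12)[Y,[Y,X]] + (1/12)[X,[X,Y]]`; `eq29_display`: for `|X|, |Y| ≤ 1/10`,
  `|log e^X e^Y − (X + Y + ½[X,Y] + (1/12)[Y,[Y,X]] + (1/12)[X,[X,Y]])| ≤ 1250 (|X| + |Y|)⁴` (the «`+ …`» is fourth order);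
  `eq29_split` (`log e^X e^Y` = the displayed polynomial + `Σ'` of the terms of degree `≥ 4`, with that bound),
  `eq29_degFour` (the terms of degree `≥ 4` alone sum to the difference); `eq29_grouped`: (29) grouped by `m` as
  printed — every inner sum `Σ_{pᵢ+qᵢ≥1}` (fixed `m`) converges and `Σ_{m≥1}` of them converges to `log e^X e^Y`.

READING (recorded, not a disagreement).  (a) For `q_m = 0` the printed factor `(ad_Y)^{q_m−1}Y` is not defined; the term
is READ, as in [7] Exercise 2.44 (d) (`ψ(w) = [Z₁,[Z₂,[⋯[Z_{n−1},Z_n]]⋯]`, `ψ(U) = U`) and [Rossmann2002] §1.3 (4), as the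
right-nested bracket of the word `X^{p₁}Y^{q₁}⋯X^{p_m}Y^{q_m}`, i.e. `⋯(ad_X)^{p_m−1}X` — it is `X` for
`(p_m, q_m) = (1, 0)` (this is how the leading `X` of «`= X + Y + …`» arises, `m = 1`) and `0` for `p_m ≥ 2`; the two
readings agree whenever the printed one is defined (`eq29_term_printed`).  (b) «convergent» is certified in the strong
sense: the multi-indexed family is (absolutely) summable, hence convergent to the same sum under any ordering/grouping,
in particular grouped by `m` as printed.  (c) SMALLNESS census: print leaves `c₀` unspecified; certified `c₀ = 1/10`
(indeed `‖X‖ + ‖Y‖ ≤ 1/5`; the majorant used converges iff `‖X‖ + ‖Y‖ < (log 2)/2 = 0.3466…`).  (d) The displayed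
third-order terms `(1/12)[Y,[Y,X]] + (1/12)[X,[X,Y]]` are the degree-`≤ 3` part of the series, evaluated term by term in
`BCH.hasSum_lowTerm` ([Rossmann2002, §1.3 Problem 2]) and restated here (§4, v1.1); the constant `1250 = 2·5⁴` of the tail
is this tree's (majorant of [Rossmann2002, §1.3 remark after (5)] rescaled to `|X| + |Y| = 1/5`), print only says «`+ …`»
(`B7Eq31BCH` §6 certifies the printed third-order SIZE statement (30)).

No new definitions of substance (one abbreviation-free file: theorems only); 0 `sorry`; nothing here is specific to
matrices.  Value = (29) is now a kernel theorem of the tree (GAPS.md N-B7-1 «typable only with a matrix-BCH library» and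
`B7Eq31BCH`/`B7Eq38Remainder` scope item «(29) itself» closed); NOT summit progress.
-/

noncomputable section

open NormedSpace
open scoped BigOperators

namespace Literature.MathematicalPhysics.QuantumFieldTheory.Balaban1983to89.B7Eq29Dynkin

open Literature.Analysis.Calculus.BCH
open Literature.Analysis.Calculus.ExpDifferential (ad ad_apply)
open MatrixLog B7Eq38Remainder B7Eq31BCH

variable {𝔸 : Type*} [NormedRing 𝔸] [NormedAlgebra ℂ 𝔸] [CompleteSpace 𝔸]

/-! ## §1  (29) for `Z = log e^X e^Y` with an admissible `c₀` -/

/-- **(29) under `|X| + |Y| ≤ 1/5`**: the Baker–Campbell–Hausdorff–Dynkin series of `log e^X e^Y` — all terms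
`((−1)^{m+1}/m)(Σ(pᵢ+qᵢ))⁻¹(Πpᵢ!qᵢ!)⁻¹[X^{(p₁)}Y^{(q₁)}⋯X^{(p_m)}Y^{(q_m)}]`, `m ≥ 1`, `pᵢ + qᵢ ≥ 1` — form a summable
family with sum `log e^X e^Y` (`log` = the series (21)). [cite: Balaban1985Averaging, (29) p.22] -/
theorem eq29_of_sum_le {X Y : 𝔸} (h : ‖X‖ + ‖Y‖ ≤ 1 / 5) : HasSum (dynkinTerm X Y) (mlog (exp X * exp Y)) :=
  hasSum_dynkinTerm X Y h

/-- **(29) AS PRINTED, with the admissible constant `c₀ = 1/10`**: for `|X| ≤ 1/10`, `|Y| ≤ 1/10`,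
`log e^X e^Y = Σ_{m≥1} Σ_{pᵢ+qᵢ≥1} ((−1)^{m+1}/m)(p₁+…+q_m)⁻¹(p₁!q₁!⋯p_m!q_m!)⁻¹(ad_X)^{p₁}(ad_Y)^{q₁}⋯(ad_X)^{p_m}(ad_Y)^{q_m−1}Y`
(HasSum of the whole multi-indexed family). [cite: Balaban1985Averaging, (29) p.22] -/
theorem eq29_printed {X Y : 𝔸} (hX : ‖X‖ ≤ 1 / 10) (hY : ‖Y‖ ≤ 1 / 10) :
    HasSum (dynkinTerm X Y) (mlog (exp X * exp Y)) :=
  eq29_of_sum_le (by linarith)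

omit [CompleteSpace 𝔸] in
/-- «the series is convergent in a neighborhood of `0`: `|X|, |Y| ≤ c₀`» — indeed ABSOLUTELY convergent for
`c₀ = 1/10`. [cite: Balaban1985Averaging, (29) p.22] -/
theorem eq29_summable_norm {X Y : 𝔸} (hX : ‖X‖ ≤ 1 / 10) (hY : ‖Y‖ ≤ 1 / 10) :
    Summable fun w => ‖dynkinTerm X Y w‖ :=
  summable_norm_dynkinTerm X Y (by linarith)

/-- (29) in `tsum` form: `log e^X e^Y = Σ' (terms of (29))` for `|X|, |Y| ≤ 1/10`. [cite: Balaban1985Averaging, (29) p.22] -/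
theorem eq29_tsum {X Y : 𝔸} (hX : ‖X‖ ≤ 1 / 10) (hY : ‖Y‖ ≤ 1 / 10) :
    mlog (exp X * exp Y) = ∑' w, dynkinTerm X Y w :=
  (tsum_dynkinTerm X Y (by linarith)).symm

/-- `c₁ ≤ c₀`: on the printed neighbourhood `|X|, |Y| ≤ c₁ = 1/10` of (31) (`B7Eq31BCH.eq31_printed`) the series (29)
converges to `Z = log e^X e^Y` AND (31) `|Z − X − Y| ≤ 2|X||Y|` holds — `c₁ = c₀ = 1/10` are admissible together.
[cite: Balaban1985Averaging, (29)–(31) p.22] -/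
theorem eq29_and_eq31 {X Y : 𝔸} (hX : ‖X‖ ≤ 1 / 10) (hY : ‖Y‖ ≤ 1 / 10) :
    HasSum (dynkinTerm X Y) (mlog (exp X * exp Y)) ∧ ‖mlog (exp X * exp Y) - X - Y‖ ≤ 2 * ‖X‖ * ‖Y‖ :=
  ⟨eq29_printed hX hY, eq31_printed hX hY⟩

/-- `exp` of the sum of (29) is `e^X e^Y` (the series solves `e^X e^Y = e^Z`). [cite: Balaban1985Averaging, (28)–(29) p.22] -/
theorem exp_eq29_tsum {X Y : 𝔸} (hX : ‖X‖ ≤ 1 / 10) (hY : ‖Y‖ ≤ 1 / 10) :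
    exp (∑' w, dynkinTerm X Y w) = exp X * exp Y :=
  exp_tsum_dynkinTerm X Y (by linarith)

/-! ## §2  (29) as the power series expansion of `Z(u,v) = log e^{uX}e^{vY}` of (28) -/

/-- **«Its power series expansion is given by the Baker-Campbell-Haussdorf formula»**: for `|u|·|X| + |v|·|Y| ≤ 1/5`,
`Z(u,v) = log e^{uX}e^{vY}` (`B7Eq38Remainder.Z2`) is the sum of the series (29) at the pair `(uX, vY)`.
[cite: Balaban1985Averaging, (28)–(29) p.22] -/
theorem eq29_Z2_of_sum_le {X Y : 𝔸} {u v : ℂ} (h : ‖u‖ * ‖X‖ + ‖v‖ * ‖Y‖ ≤ 1 / 5) :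
    HasSum (dynkinTerm (u • X) (v • Y)) (Z2 X Y (u, v)) := by
  have h' : ‖u • X‖ + ‖v • Y‖ ≤ 1 / 5 := by rwa [norm_smul, norm_smul]
  exact hasSum_dynkinTerm (u • X) (v • Y) h'

/-- (29) for `Z(u,v)` on `|uX| ≤ 1/10`, `|vY| ≤ 1/10` (inside the printed domain `|uX| < ⅛`, `|vY| < ⅛` this is the
certified part). [cite: Balaban1985Averaging, (28)–(29) p.22] -/
theorem eq29_Z2 {X Y : 𝔸} {u v : ℂ} (hu : ‖u‖ * ‖X‖ ≤ 1 / 10) (hv : ‖v‖ * ‖Y‖ ≤ 1 / 10) :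
    HasSum (dynkinTerm (u • X) (v • Y)) (Z2 X Y (u, v)) :=
  eq29_Z2_of_sum_le (by linarith)

/-- At `u = v = 1`: `Z(1,1) = Z = log e^X e^Y = Σ' (29)`. [cite: Balaban1985Averaging, (28)–(29) p.22] -/
theorem Z2_one_one_eq_tsum {X Y : 𝔸} (hX : ‖X‖ ≤ 1 / 10) (hY : ‖Y‖ ≤ 1 / 10) :
    Z2 X Y (1, 1) = ∑' w, dynkinTerm X Y w := by
  rw [← eq29_tsum hX hY, Z2]
  simp

/-! ## §3  The printed general term and the displayed low-order terms -/

omit [CompleteSpace 𝔸] in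
/-- **THE PRINTED GENERAL TERM.**  If the last block has `q_m ≥ 1`, the bracket `[X^{(p₁)}Y^{(q₁)}⋯X^{(p_m)}Y^{(q_m)}]`
of the multi-index `f = ((p₁,q₁),…,(p_m,q_m))` (`m = k+1`) IS the printed operator word
`(ad_X)^{p₁}(ad_Y)^{q₁}⋯(ad_X)^{p_{m−1}}(ad_Y)^{q_{m−1}} · (ad_X)^{p_m}(ad_Y)^{q_m−1} Y`, `ad_X Y = XY − YX`.
[cite: Balaban1985Averaging, (29) p.22] -/
theorem eq29_term_printed (X Y : 𝔸) {k : ℕ} (f : Fin (k + 1) → Blk) (hq : 1 ≤ (f (Fin.last k)).1.2) :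
    dynkinBracket X Y f = wordProd (fun i : Blk => (ad ℂ X) ^ i.1.1 * (ad ℂ Y) ^ i.1.2) (Fin.init f)
      (((ad ℂ X) ^ (f (Fin.last k)).1.1 * (ad ℂ Y) ^ ((f (Fin.last k)).1.2 - 1)) Y) :=
  dynkinBracket_eq_printed X Y f hq

omit [CompleteSpace 𝔸] in
/-- `ad_X Y = [X, Y] = XY − YX`. [cite: Balaban1985Averaging, (29) p.22] -/
theorem ad_eq_comm (X Y : 𝔸) : ad ℂ X Y = X * Y - Y * X := ad_apply X Y

omit [CompleteSpace 𝔸] in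
/-- The contribution of the LAST block `(p_m, q_m)`: `(ad_X)^{p_m} Y` if `q_m = 1`, `X` if `(p_m,q_m) = (1,0)`, and `0`
otherwise (`(ad_Y)^{q_m−1}Y = 0` for `q_m ≥ 2`, `(ad_X)^{p_m−1}X = 0` for `p_m ≥ 2`) — so only these multi-indices give
nonzero terms in (29). [cite: Balaban1985Averaging, (29) p.22] -/
theorem eq29_lastBlock (X Y : 𝔸) (i : Blk) :
    vecLetter X Y i = if i.1.2 = 1 then ((ad ℂ X) ^ i.1.1) Y else if i.1.2 = 0 ∧ i.1.1 = 1 then X else 0 :=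
  vecLetter_eq X Y i

omit [CompleteSpace 𝔸] in
/-- The displayed leading term `X` of «`= X + Y + ½[X,Y] + …`» is the term `m = 1`, `(p₁,q₁) = (1,0)`.
[cite: Balaban1985Averaging, (29) p.22] -/
theorem eq29_term_X (X Y : 𝔸) : dynkinTerm X Y ⟨0, fun _ => blkX⟩ = X := dynkinTerm_X X Y

omit [CompleteSpace 𝔸] in
/-- The displayed term `Y` is the term `m = 1`, `(p₁,q₁) = (0,1)`. [cite: Balaban1985Averaging, (29) p.22] -/
theorem eq29_term_Y (X Y : 𝔸) : dynkinTerm X Y ⟨0, fun _ => blkY⟩ = Y := dynkinTerm_Y X Y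

omit [CompleteSpace 𝔸] in
/-- The displayed term `½[X, Y]` is the term `m = 1`, `(p₁,q₁) = (1,1)` (the two other degree-2 words with a nonzero
bracket, at `m = 2`, contribute `−¼[X,Y] − ¼[Y,X] = 0`). [cite: Balaban1985Averaging, (29) p.22] -/
theorem eq29_term_XY (X Y : 𝔸) : dynkinTerm X Y ⟨0, fun _ => blkXY⟩ = (2 : ℂ)⁻¹ • (X * Y - Y * X) :=
  dynkinTerm_XY X Y

/-! ## §4  The displayed third-order terms and the fourth-order tail (v1.1) -/

omit [CompleteSpace 𝔸] in
/-- The displayed polynomial of (29) is the tree's cubic BCH polynomial `BCH.bch3`. [cite: Balaban1985Averaging, (29) p.22] -/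
theorem eq29_displayed_eq_bch3 (X Y : 𝔸) :
    X + Y + (2 : ℂ)⁻¹ • ad ℂ X Y + (12 : ℂ)⁻¹ • ad ℂ Y (ad ℂ Y X) + (12 : ℂ)⁻¹ • ad ℂ X (ad ℂ X Y) = bch3 X Y := by
  simp only [bch3, ad_apply, smul_add]
  abel

omit [CompleteSpace 𝔸] in
/-- **THE DISPLAYED THIRD-ORDER TERMS «`= X + Y + ½[X, Y] + (1/12)[Y, [Y, X]] + (1/12)[X, [X, Y]] + …`».**  The terms of
(29) of total degree `p₁ + q₁ + … + p_m + q_m ≤ 3` — finitely many (`BCH.lowTerm` = the term if its degree is `≤ 3`, else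
`0`) — sum EXACTLY to `X + Y + ½ ad_X Y + (1/12) ad_Y(ad_Y X) + (1/12) ad_X(ad_X Y)`, `ad_X Y = [X,Y] = XY − YX`
(no smallness needed: a finite sum). [cite: Balaban1985Averaging, (29) p.22] -/
theorem eq29_lowDeg (X Y : 𝔸) :
    HasSum (lowTerm X Y)
      (X + Y + (2 : ℂ)⁻¹ • ad ℂ X Y + (12 : ℂ)⁻¹ • ad ℂ Y (ad ℂ Y X) + (12 : ℂ)⁻¹ • ad ℂ X (ad ℂ X Y)) := by
  rw [eq29_displayed_eq_bch3]
  exact hasSum_lowTerm X Y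

/-- **(29) AS DISPLAYED, the «`+ …`» made quantitative**: for `|X| ≤ 1/10`, `|Y| ≤ 1/10`,
`|log e^X e^Y − (X + Y + ½[X,Y] + (1/12)[Y,[Y,X]] + (1/12)[X,[X,Y]])| ≤ 1250 (|X| + |Y|)⁴`.
[cite: Balaban1985Averaging, (29) p.22] -/
theorem eq29_display {X Y : 𝔸} (hX : ‖X‖ ≤ 1 / 10) (hY : ‖Y‖ ≤ 1 / 10) :
    ‖mlog (exp X * exp Y) -
        (X + Y + (2 : ℂ)⁻¹ • ad ℂ X Y + (12 : ℂ)⁻¹ • ad ℂ Y (ad ℂ Y X) + (12 : ℂ)⁻¹ • ad ℂ X (ad ℂ X Y))‖ ≤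
      1250 * (‖X‖ + ‖Y‖) ^ 4 := by
  rw [eq29_displayed_eq_bch3]
  exact norm_logOnePlus_sub_bch3_le X Y (by linarith)

/-- **The «`+ …`» of (29)**: `log e^X e^Y` = the displayed polynomial + the sum of the terms of (29) of degree `≥ 4`
(`BCH.highTerm`), and that tail is `≤ 1250 (|X| + |Y|)⁴`, for `|X|, |Y| ≤ 1/10`. [cite: Balaban1985Averaging, (29) p.22] -/
theorem eq29_split {X Y : 𝔸} (hX : ‖X‖ ≤ 1 / 10) (hY : ‖Y‖ ≤ 1 / 10) :
    mlog (exp X * exp Y) =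
        X + Y + (2 : ℂ)⁻¹ • ad ℂ X Y + (12 : ℂ)⁻¹ • ad ℂ Y (ad ℂ Y X) + (12 : ℂ)⁻¹ • ad ℂ X (ad ℂ X Y) +
          ∑' w, highTerm X Y w ∧
      ‖∑' w, highTerm X Y w‖ ≤ 1250 * (‖X‖ + ‖Y‖) ^ 4 := by
  rw [eq29_displayed_eq_bch3]
  exact logOnePlus_eq_bch3_add_tsum X Y (by linarith)

/-- The terms of (29) of degree `≥ 4` alone (as a family over that index subtype) sum to
`log e^X e^Y − (X + Y + ½[X,Y] + (1/12)[Y,[Y,X]] + (1/12)[X,[X,Y]])`, `|X|, |Y| ≤ 1/10`. [cite: Balaban1985Averaging, (29) p.22] -/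
theorem eq29_degFour {X Y : 𝔸} (hX : ‖X‖ ≤ 1 / 10) (hY : ‖Y‖ ≤ 1 / 10) :
    HasSum (fun w : {w : Idx // 4 ≤ deg w.2} => dynkinTerm X Y w)
      (mlog (exp X * exp Y) -
        (X + Y + (2 : ℂ)⁻¹ • ad ℂ X Y + (12 : ℂ)⁻¹ • ad ℂ Y (ad ℂ Y X) + (12 : ℂ)⁻¹ • ad ℂ X (ad ℂ X Y))) := by
  rw [eq29_displayed_eq_bch3]
  exact hasSum_dynkinTerm_degFour X Y (by linarith)

/-- **(29) GROUPED BY `m` AS PRINTED** («`Σ_{m=1}^∞ Σ_{pᵢ+qᵢ≥1} …`»): for `|X|, |Y| ≤ 1/10` each inner sum over the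
multi-indices with `m = k + 1` blocks converges, and the outer series over `m` converges to `log e^X e^Y` (a consequence
of the absolute summability of the whole family, `eq29_summable_norm`). [cite: Balaban1985Averaging, (29) p.22] -/
theorem eq29_grouped {X Y : 𝔸} (hX : ‖X‖ ≤ 1 / 10) (hY : ‖Y‖ ≤ 1 / 10) :
    HasSum (fun k : ℕ => ∑' f : Fin (k + 1) → Blk, dynkinTerm X Y ⟨k, f⟩) (mlog (exp X * exp Y)) :=
  (eq29_printed hX hY).sigma fun k => ((eq29_summable_norm hX hY).of_norm.sigma_factor k).hasSum

end Literature.MathematicalPhysics.QuantumFieldTheory.Balaban1983to89.B7Eq29Dynkin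

end
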